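import Mathlib.AlgebraicGeometry.Sites.ElladicCohomology
import Mathlib.CategoryTheory.Sites.EpiMono
import Literature.AlgebraicGeometry.Motives.EtaleToProetCovers
import HarnessLib

/-!
# Affine covers in `X_proét`: Zariski reduction, finite disjoint unions and lifting covers

Infrastructure for the exactness of countable products in `Shv(X_proét)` (Bhatt–Scholze,
*The pro-étale topology for schemes*, Prop. 3.1.9 via the tower argument of Example 3.1.7), on
Mathlib's small pro-étale site `X.ProEt` (weakly étale `X`-schemes, fpqc covers, Def. 4.1.1);
the companion file `ProetAffineAlgebra.lean` holds the dictionary with weakly étale algebras: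

* `ofArrows_affineOpens_mem_proEtTopology` — the affine opens of any `U ∈ X_proét` form a
  pro-étale cover (Zariski covers are fpqc covers);
* `proetSigma W` — the disjoint union of finitely many `W_k ∈ X_proét`, with
  `proetSigma_sections_bijective`: **sections of a sheaf over `∐ W_k` are families of sections
  over the `W_k`** (the `W_k → ∐ W_k` form a cover with pairwise empty overlaps);
* `LiftingCover φ U s` / `nonempty_liftingCover` — for an epimorphism of abelian sheaves
  `φ : F → G`, an affine `U` and a section `s ∈ G(U)`, **there is an affine `V → U` in `X_proét`,
  surjective, over which `s` lifts to `F`** (local surjectivity, Def. 4.1.1 "any open affine … is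
  mapped onto by an open affine", and the gluing above).

## References

* B. Bhatt, P. Scholze, *The pro-étale topology for schemes*, Astérisque 369 (2015)
  (arXiv:1309.1198): Def. 4.1.1, Lemma 4.1.7, Lemma 4.1.8, Example 3.1.7. [BhattScholze2015]

## Design notes

* Sheaves are `Sheaf (Scheme.ProEt.topology X) Ab.{u+1}` (the coefficients of Mathlib's
  `Scheme.EllAdicCohomology` and of `ProetCohomology`).
* Mathlib searches: `Scheme.ProEt` (site, topology, `bot_mem_topology`),
  `Sheaf.isLocallySurjective_iff_epi'`, `isEmpty_of_commSq_sigmaι_of_ne`,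
  `Sheaf.isTerminalOfBotCover`, `Presieve.isSheafFor_arrows_iff`, `IsZariskiLocalAtSource.sigmaDesc`;
  Literature `exists_finite_affine_of_mem_proEtTopology`, `ofArrows_mem_proEtTopology`,
  `weaklyEtale_left` (reused). Nothing restated.
-/

universe u

open CategoryTheory CategoryTheory.Limits Opposite AlgebraicGeometry

noncomputable section

-- `X.ProEt = MorphismProperty.Over @WeaklyEtale ⊤ X` feeds the class `@WeaklyEtale` where a
-- `MorphismProperty` is expected; as in Mathlib's `AlgebraicGeometry/Sites/Proetale.lean`, the
-- unifier must be allowed to unfold it when rewriting in goals mentioning objects of `X.ProEt`.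
set_option backward.isDefEq.respectTransparency false

namespace Literature.AlgebraicGeometry.Motives

variable {X : Scheme.{u}}

/-! ### Affine opens form a pro-étale cover -/

section Zariski

variable (U : X.ProEt)

/-- An affine open `O ⊆ U` of `U ∈ X_proét` as an object of `X_proét` (`O ↪ U → X` is weakly
étale). [folklore] -/
def proetOfAffineOpen (O : U.left.affineOpens) : X.ProEt :=
  MorphismProperty.Over.mk ⊤ ((O : U.left.Opens).ι ≫ U.hom)
    (MorphismProperty.comp_mem _ _ _ (inferInstance : WeaklyEtale (O : U.left.Opens).ι) U.prop)

/-- The inclusion `O ⟶ U` in `X_proét`. [folklore] -/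
def proetOfAffineOpenι (O : U.left.affineOpens) : proetOfAffineOpen U O ⟶ U :=
  MorphismProperty.Over.homMk (O : U.left.Opens).ι rfl

/-- Its underlying scheme is `O` (by `rfl`). [folklore] -/
@[simp] theorem proetOfAffineOpen_left (O : U.left.affineOpens) :
    (proetOfAffineOpen U O).left = (O : U.left.Opens) := rfl

/-- Its underlying morphism is the open immersion `O ↪ U` (by `rfl`). [folklore] -/
@[simp] theorem proetOfAffineOpenι_left (O : U.left.affineOpens) :
    (proetOfAffineOpenι U O).left = (O : U.left.Opens).ι := rfl

/-- Affine opens have affine underlying scheme. [folklore] -/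
instance isAffine_proetOfAffineOpen_left (O : U.left.affineOpens) :
    IsAffine (proetOfAffineOpen U O).left := O.2

/-- **The affine opens of any `U ∈ X_proét` generate a pro-étale covering sieve** (a Zariski
cover is an fpqc cover by weakly étale maps, Bhatt–Scholze Def. 4.1.1; Mathlib
`zariskiPrecoverage_le_propQCPrecoverage`). [cite: BhattScholze2015, Def. 4.1.1] -/
theorem ofArrows_affineOpens_mem_proEtTopology :
    Sieve.ofArrows _ (proetOfAffineOpenι U) ∈ Scheme.ProEt.topology X U := by
  let 𝒰 : U.left.OpenCover := U.left.openCoverOfIsOpenCover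
    (fun O : U.left.affineOpens => (O : U.left.Opens)) (iSup_affineOpens_eq_top U.left)
  have h𝒰 : Presieve.ofArrows (fun O : U.left.affineOpens => ((O : U.left.Opens) : Scheme))
      (fun O => (O : U.left.Opens).ι) ∈ Scheme.proetalePrecoverage U.left :=
    Scheme.zariskiPrecoverage_le_propQCPrecoverage _ 𝒰.mem₀
  have hmem : Presieve.ofArrows _ (proetOfAffineOpenι U) ∈ Scheme.ProEt.precoverage X U := by
    rw [Scheme.ProEt.precoverage, Precoverage.mem_comap_iff, Presieve.map_ofArrows]
    exact h𝒰
  exact Precoverage.generate_mem_toGrothendieck hmem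

end Zariski

/-! ### Finite disjoint unions in `X_proét` and gluing of sections -/

section Sigma

variable {n : ℕ} (W : Fin n → X.ProEt)

/-- The disjoint union `∐ W_k` of finitely many objects of `X_proét`, as an object of `X_proét`
(weakly étale is Zariski-local on the source, Mathlib `IsZariskiLocalAtSource.sigmaDesc`).
[folklore] -/
def proetSigma : X.ProEt :=
  MorphismProperty.Over.mk ⊤
    (Sigma.desc (f := fun k => (W k).left) fun k => ((W k).hom : (W k).left ⟶ X))
    (IsZariskiLocalAtSource.sigmaDesc fun k => (W k).prop)

/-- Its underlying scheme is the coproduct `∐ W_k` (by `rfl`). [folklore] -/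
@[simp] theorem proetSigma_left : (proetSigma W).left = ∐ fun k => (W k).left := rfl

/-- Its structure map is induced by the structure maps of the `W_k` (by `rfl`). [folklore] -/
@[simp] theorem proetSigma_hom :
    (proetSigma W).hom =
      Sigma.desc (f := fun k => (W k).left) fun k => ((W k).hom : (W k).left ⟶ X) := rfl

/-- The summand inclusions `W_k ⟶ ∐ W_k`. [folklore] -/
def proetSigmaι (k : Fin n) : W k ⟶ proetSigma W :=
  MorphismProperty.Over.homMk (Sigma.ι (fun k => (W k).left) k) (Sigma.ι_desc _ _)

/-- The underlying morphism of the summand inclusion is `Sigma.ι` (by `rfl`). [folklore] -/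
@[simp] theorem proetSigmaι_left (k : Fin n) :
    (proetSigmaι W k).left = Sigma.ι (fun k => (W k).left) k := rfl

/-- A finite disjoint union of affine objects is affine. [folklore] -/
instance isAffine_proetSigma_left [∀ k, IsAffine (W k).left] : IsAffine (proetSigma W).left :=
  inferInstanceAs (IsAffine (∐ fun k => (W k).left))

variable {W} in
/-- The map `∐ W_k ⟶ U` induced by a family `W_k ⟶ U`. [folklore] -/
def proetSigmaDesc {U : X.ProEt} (g : ∀ k, W k ⟶ U) : proetSigma W ⟶ U :=
  MorphismProperty.Over.homMk (Sigma.desc fun k => (g k).left) (by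
    refine Sigma.hom_ext _ _ fun k => ?_
    rw [proetSigma_hom, Sigma.ι_desc_assoc, Sigma.ι_desc]
    exact MorphismProperty.Over.w (g k))

/-- The underlying morphism of the induced map is `Sigma.desc` (by `rfl`). [folklore] -/
@[simp] theorem proetSigmaDesc_left {U : X.ProEt} (g : ∀ k, W k ⟶ U) :
    (proetSigmaDesc g).left = Sigma.desc fun k => (g k).left := rfl

/-- The induced map restricts to `g k` on the summand `W_k`. [folklore] -/
@[simp] theorem proetSigmaι_desc {U : X.ProEt} (g : ∀ k, W k ⟶ U) (k : Fin n) :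
    proetSigmaι W k ≫ proetSigmaDesc g = g k :=
  MorphismProperty.Over.Hom.ext (Sigma.ι_desc _ _)

/-- The summand inclusions are monomorphisms of `X_proét` (they are open immersions). [folklore] -/
instance mono_proetSigmaι (k : Fin n) : Mono (proetSigmaι W k) :=
  (Scheme.ProEt.forget X ⋙ Over.forget X).mono_of_mono_map
    (inferInstanceAs (Mono (Sigma.ι (fun k => (W k).left) k)))

/-- Every point of `∐ W_k` lies in some summand. [folklore] -/
theorem exists_proetSigmaι_eq (x : (proetSigma W).left) :
    ∃ (k : Fin n) (y : (W k).left), (proetSigmaι W k).left y = x :=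
  (sigmaOpenCover fun k => (W k).left).exists_eq x

/-- **The summand inclusions `W_k ⟶ ∐ W_k` generate a pro-étale covering sieve** when the `W_k`
are affine (a finite jointly surjective family of affines). [cite: BhattScholze2015, Def. 4.1.1] -/
theorem ofArrows_proetSigmaι_mem [∀ k, IsAffine (W k).left] :
    Sieve.ofArrows _ (proetSigmaι W) ∈ Scheme.ProEt.topology X (proetSigma W) :=
  ofArrows_mem_proEtTopology W (proetSigmaι W) (exists_proetSigmaι_eq W)

/-- An object of `X_proét` with empty underlying scheme has only one section. [folklore] -/
theorem subsingleton_proetSections_of_isEmpty (F : Sheaf (Scheme.ProEt.topology X) Ab.{u + 1})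
    (Z : X.ProEt) [IsEmpty Z.left] : Subsingleton (F.obj.obj (op Z)) :=
  AddCommGrpCat.subsingleton_of_isZero
    (F.isTerminalOfBotCover Z (Scheme.ProEt.bot_mem_topology Z)).isZero

/-- Any family of sections over the summands is compatible along the (pairwise disjoint)
inclusions `W_k ⟶ ∐ W_k`. [folklore] -/
theorem arrows_compatible_proetSigmaι (F : Sheaf (Scheme.ProEt.topology X) Ab.{u + 1})
    (x : ∀ k, F.obj.obj (op (W k))) :
    Presieve.Arrows.Compatible (F.obj ⋙ forget Ab.{u + 1}) (proetSigmaι W) x := by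
  intro k l Z a b hab
  by_cases hkl : k = l
  · subst hkl
    obtain rfl : a = b := (cancel_mono (proetSigmaι W k)).1 hab
    rfl
  · have hcomm : a.left ≫ Sigma.ι (fun k => (W k).left) k =
        b.left ≫ Sigma.ι (fun k => (W k).left) l := by
      exact congrArg (fun q => q.left) hab
    haveI : IsEmpty Z.left := isEmpty_of_commSq_sigmaι_of_ne ⟨hcomm⟩ hkl
    exact (subsingleton_proetSections_of_isEmpty F Z).elim _ _

/-- **Sections over a finite disjoint union are families of sections over the summands**: for a
sheaf `F` on `X_proét` and affine `W_k`, `t ↦ (t|_{W_k})_k` is a bijection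
`F(∐ W_k) ≃ ∏_k F(W_k)` (sheaf condition for the cover `{W_k → ∐ W_k}`, all families being
compatible). [folklore] -/
theorem proetSigma_sections_bijective [∀ k, IsAffine (W k).left]
    (F : Sheaf (Scheme.ProEt.topology X) Ab.{u + 1}) :
    Function.Bijective fun (t : F.obj.obj (op (proetSigma W))) (k : Fin n) =>
      F.obj.map (proetSigmaι W k).op t := by
  have hsh : Presieve.IsSheaf (Scheme.ProEt.topology X) (F.obj ⋙ forget Ab.{u + 1}) :=
    (isSheaf_iff_isSheaf_of_type _ _).1
      ((sheafCompose (Scheme.ProEt.topology X) (forget Ab.{u + 1})).obj F).property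
  have h := (Presieve.isSheafFor_arrows_iff (F.obj ⋙ forget Ab.{u + 1}) (proetSigmaι W)).1
    ((Presieve.isSheafFor_iff_generate _).2 (hsh _ (ofArrows_proetSigmaι_mem W)))
  constructor
  · intro t t' htt'
    exact (h _ (arrows_compatible_proetSigmaι W F _)).unique (fun k => rfl)
      fun k => (congr_fun htt' k).symm
  · intro x
    obtain ⟨t, ht, -⟩ := h x (arrows_compatible_proetSigmaι W F x)
    exact ⟨t, funext ht⟩

end Sigma

/-! ### Lifting covers for an epimorphism of sheaves -/

section Lifting

variable {F G : Sheaf (Scheme.ProEt.topology X) Ab.{u + 1}} (φ : F ⟶ G) (U : X.ProEt)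
  (s : G.obj.obj (op U))

/-- A **lifting cover** for a section `s ∈ G(U)` along `φ : F → G`: an affine `V ∈ X_proét` with a
surjective map `V → U` of `X_proét` and a section of `F` over `V` mapping to `s|_V`. [folklore] -/
structure LiftingCover where
  /-- the covering object `V` -/
  obj : X.ProEt
  /-- the structure map `V ⟶ U` -/
  hom : obj ⟶ U
  /-- `V` is affine -/
  isAffine : IsAffine obj.left
  /-- `V ⟶ U` is surjective -/
  surjective : Surjective hom.left
  /-- the lift of `s|_V` -/
  lift : F.obj.obj (op obj)
  /-- the lift maps to `s|_V` -/
  map_lift : φ.hom.app (op obj) lift = G.obj.map hom.op s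

/-- **Sections of the target of an epimorphism of abelian sheaves on `X_proét` lift over an
affine surjective cover.** For `φ : F → G` epi, `U` affine and `s ∈ G(U)`: `φ` is locally
surjective, so `s` lifts over the members of a covering sieve; finitely many affine members
`W_k → U` already map onto `U` (Bhatt–Scholze Def. 4.1.1), and the lifts over the `W_k` glue to a
lift over the affine `∐ W_k → U` (`proetSigma_sections_bijective`). This is the inductive step of
the tower in Bhatt–Scholze Example 3.1.7. [cite: BhattScholze2015, Example 3.1.7] -/
theorem nonempty_liftingCover [Epi φ] [IsAffine U.left] : Nonempty (LiftingCover φ U s) := by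
  haveI : Sheaf.IsLocallySurjective φ :=
    (Sheaf.isLocallySurjective_iff_epi' Ab.{u + 1} φ).2 inferInstance
  have hmem : Presheaf.imageSieve φ.hom s ∈ Scheme.ProEt.topology X U :=
    Presheaf.imageSieve_mem _ φ.hom s
  obtain ⟨n, W, g, hW, hg, hsurj⟩ := exists_finite_affine_of_mem_proEtTopology hmem
  haveI := hW
  choose t ht using hg
  obtain ⟨T, hT⟩ := (proetSigma_sections_bijective W F).2 t
  refine ⟨⟨proetSigma W, proetSigmaDesc g, inferInstance, ⟨fun x => ?_⟩, T, ?_⟩⟩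
  · obtain ⟨k, y, rfl⟩ := hsurj x
    exact ⟨(proetSigmaι W k).left y, congrArg (fun q : W k ⟶ U => q.left y) (proetSigmaι_desc W g k)⟩
  · apply (proetSigma_sections_bijective W G).1
    funext k
    have hTk : F.obj.map (proetSigmaι W k).op T = t k := congr_fun hT k
    change G.obj.map (proetSigmaι W k).op (φ.hom.app _ T) =
      G.obj.map (proetSigmaι W k).op (G.obj.map (proetSigmaDesc g).op s)
    rw [← ConcreteCategory.comp_apply, ← φ.hom.naturality, ConcreteCategory.comp_apply]
    change φ.hom.app _ (F.obj.map (proetSigmaι W k).op T) = _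
    rw [hTk, ht k, ← ConcreteCategory.comp_apply, ← G.obj.map_comp, ← op_comp, proetSigmaι_desc W g k]

variable {φ U s} in
/-- The structure map of a lifting cover is weakly étale (any map in `X_proét` is). [folklore] -/
instance LiftingCover.weaklyEtale (L : LiftingCover φ U s) : WeaklyEtale L.hom.left :=
  weaklyEtale_left L.hom

/-- A choice of lifting cover. [folklore] -/
def liftingCover [Epi φ] [IsAffine U.left] : LiftingCover φ U s :=
  (nonempty_liftingCover φ U s).some

end Lifting

end Literature.AlgebraicGeometry.Motives

end
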